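import Mathlib.Analysis.SpecialFunctions.JapaneseBracket
import Mathlib.Analysis.SpecialFunctions.Pow.Integral
import Literature.Analysis.FluidPDE.TaoForcedNormalisedPressure
import Literature.Analysis.UnboundedOperators.HeatKernel
import HarnessLib

/-!
# The force potential `Δ⁻¹∇·g` of a bounded integrable force slice is square integrable

Analysis/FluidPDE file (cell `pub/ns-blowup`, seat `ns-blowup-ecbridge-2` g2; PATH B of the
`E–C` endpoint, LIT-DOSSIER §41 / planner WORD STATUS l.1312). WHAT THIS IS NOT: not a statement
about Navier–Stokes — an elementary potential estimate (Young's inequality), used by the forced twin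
of `isLerayHopfOn_of_finiteEnergy` (`TaoForcedFiniteEnergyLerayHopf`) to control the second term
`Δ⁻¹∇·f` of Tao's normalised pressure (9) `p = -Δ⁻¹∂ᵢ∂ⱼ(uᵢuⱼ) + Δ⁻¹∇·f` (Tao 2011 =
arXiv:1108.1165, (9) p. 5; Lemma 4.1 (i)) in the localised energy balance.

For a force slice `g : ℝ³ → ℝ³` the tree's `forcePotential g x = ∫ ∇Γ(x - y)·g(y) dy`
(`TaoForcedNormalisedPressure`, kernel `forceKernel z v = ⟨z, v⟩/(4π|z|³)`, `|forceKernel z v| ≤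
|v|/(4π|z|²)`). Splitting the majorant kernel `κ(z) = (4π|z|²)⁻¹` at `|z| = 1` into
`κ₁ = κ·1_{|z|<1} ∈ L¹(ℝ³)` (`2 < 3`) and `κ₂ = κ·1_{|z|≥1} ∈ L²(ℝ³)` (`4 > 3`), Young's
inequality `‖k ⋆ h‖₂ ≤ ‖k‖₁‖h‖₂` (the tree's
`Literature.Analysis.UnboundedOperators.eLpNorm_convolution_le_lintegral_enorm_mul`), used once with
`(k, h) = (κ₁, |g|)` and once with `(k, h) = (|g|, κ₂)`, gives for `g` continuous, bounded and
integrable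

  `‖Δ⁻¹∇·g‖_{L²} ≤ ‖κ₁‖_{L¹} ‖g‖_{L²} + ‖g‖_{L¹} ‖κ₂‖_{L²} < ∞`

(`eLpNorm_forcePotential_le`, `eLpNorm_forcePotential_lt_top`), together with the measurability of
`Δ⁻¹∇·g` (`aestronglyMeasurable_forcePotential`). (Gilbarg–Trudinger (2.12)–(2.14): `∇Γ` is
`O(|z|^{1-d})`; the split is the standard proof that the Riesz potential of order one maps
`L¹ ∩ L²(ℝ³)` into `L²`.)

## Mathlib / tree search

Mathlib: `integrableOn_ball_of_norm_le_rpow`, `integrable_one_add_norm` (radial integrability),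
`MeasureTheory.convolution`, `convolution_flip`, `Integrable.comp_sub_left`,
`integral_sub_left_eq_self`, `StronglyMeasurable.integral_prod_right`; no Hardy–Littlewood–Sobolev
inequality in Mathlib (`lean search 'HardyLittlewoodSobolev|rieszPotential'` — nothing usable).
Tree: `forceKernel`, `forcePotential`, `forceKernel_eq_fin3` (`TaoForcedNormalisedPressure`), Young's
inequality `eLpNorm_convolution_le_lintegral_enorm_mul` (`UnboundedOperators/HeatKernel`).

## References

* T. Tao, *Localisation and compactness properties of the Navier–Stokes global regularity
  problem*, Anal. PDE 6 (2013) = arXiv:1108.1165 (`Tao2011`): (9) p. 5, Lemma 4.1 (i) p. 14.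
* D. Gilbarg, N. S. Trudinger, *Elliptic partial differential equations of second order* (2001)
  (`GilbargTrudinger2001`): (2.12)–(2.14), Lemma 7.12 (potential estimates).
-/

noncomputable section

open MeasureTheory Set Filter Metric Topology Real
open scoped ENNReal NNReal RealInnerProductSpace

namespace Literature.Analysis.FluidPDE


/-! ## The majorant kernel `κ(z) = (4π|z|²)⁻¹` and its near/far parts -/

/-- **Pointwise bound of the force kernel**: `|∇Γ(z)·v| ≤ |v|/(4π|z|²)` (Cauchy–Schwarz; at
`z = 0` both sides vanish). [cite: GilbargTrudinger2001, (2.14)] -/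
theorem abs_forceKernel_le (z v : (EuclideanSpace ℝ (Fin 3))) : |forceKernel z v| ≤ (4 * π * ‖z‖ ^ 2)⁻¹ * ‖v‖ := by
  rw [forceKernel_eq_fin3]
  rcases eq_or_ne z 0 with rfl | hz
  · simp
  have hz' : 0 < ‖z‖ := norm_pos_iff.2 hz
  rw [abs_div, abs_of_pos (by positivity : 0 < 4 * π * ‖z‖ ^ 3), div_le_iff₀ (by positivity)]
  calc |⟪z, v⟫| ≤ ‖z‖ * ‖v‖ := abs_real_inner_le_norm z v
    _ = (4 * π * ‖z‖ ^ 2)⁻¹ * ‖v‖ * (4 * π * ‖z‖ ^ 3) := by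
        field_simp

/-- The majorant kernel is nonnegative. [folklore] -/
private theorem forceMajorant_nonneg (z : (EuclideanSpace ℝ (Fin 3))) : 0 ≤ (4 * π * ‖z‖ ^ 2)⁻¹ := by positivity

/-- The majorant kernel is measurable. [folklore] -/
private theorem measurable_forceMajorant : Measurable fun z : (EuclideanSpace ℝ (Fin 3)) => (4 * π * ‖z‖ ^ 2)⁻¹ :=
  ((continuous_const.mul (continuous_norm.pow 2)).measurable).inv

/-- **The near part `κ₁ = κ·1_{B(0,1)}` is integrable**: `|z|⁻²` with `2 < 3 = dim` on the unit
ball (Mathlib `integrableOn_ball_of_norm_le_rpow`). [cite: GilbargTrudinger2001, (2.14)] -/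
theorem integrable_forceMajorant_near :
    Integrable ((ball (0 : (EuclideanSpace ℝ (Fin 3))) 1).indicator fun z : (EuclideanSpace ℝ (Fin 3)) => (4 * π * ‖z‖ ^ 2)⁻¹) := by
  rw [integrable_indicator_iff measurableSet_ball]
  refine integrableOn_ball_of_norm_le_rpow (by rw [finrank_euclideanSpace_fin]; norm_num)
    (C := (4 * π)⁻¹) (α := 2) (by rw [finrank_euclideanSpace_fin]; norm_num)
    (Eventually.of_forall fun z => ?_) measurable_forceMajorant.aestronglyMeasurable
  rw [Real.norm_of_nonneg (forceMajorant_nonneg z), mul_inv, Real.rpow_neg (norm_nonneg _),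
    Real.rpow_two]

/-- **The far part `κ₂ = κ·1_{B(0,1)ᶜ}` is square integrable**: `|z|⁻⁴ ≤ 16(1+|z|)⁻⁴` for
`|z| ≥ 1`, and `4 > 3 = dim` (Mathlib `integrable_one_add_norm`). [cite: GilbargTrudinger2001, (2.14)] -/
theorem memLp_forceMajorant_far :
    MemLp ((ball (0 : (EuclideanSpace ℝ (Fin 3))) 1)ᶜ.indicator fun z : (EuclideanSpace ℝ (Fin 3)) => (4 * π * ‖z‖ ^ 2)⁻¹) 2 volume := by
  have hmeas : AEStronglyMeasurable ((ball (0 : (EuclideanSpace ℝ (Fin 3))) 1)ᶜ.indicator fun z : (EuclideanSpace ℝ (Fin 3)) => (4 * π * ‖z‖ ^ 2)⁻¹)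
      volume :=
    (measurable_forceMajorant.indicator measurableSet_ball.compl).aestronglyMeasurable
  rw [memLp_two_iff_integrable_sq hmeas]
  have hint : Integrable (fun z : (EuclideanSpace ℝ (Fin 3)) => 16 * (4 * π)⁻¹ ^ 2 * (1 + ‖z‖) ^ (-(4 : ℝ))) volume :=
    (integrable_one_add_norm (by rw [finrank_euclideanSpace_fin]; norm_num)).const_mul _
  refine hint.mono' ((hmeas.aemeasurable.pow_const 2).aestronglyMeasurable)
    (Eventually.of_forall fun z => ?_)
  rw [Real.norm_of_nonneg (sq_nonneg _)]
  by_cases hz : z ∈ (ball (0 : (EuclideanSpace ℝ (Fin 3))) 1)ᶜ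
  · rw [indicator_of_mem hz]
    rw [mem_compl_iff, mem_ball_zero_iff, not_lt] at hz
    have h1 : 0 < ‖z‖ := one_pos.trans_le hz
    have h2 : (1 + ‖z‖) ^ (-(4 : ℝ)) = ((1 + ‖z‖) ^ 4)⁻¹ := by
      rw [Real.rpow_neg (by positivity), ← Real.rpow_natCast]
      norm_num
    have h4 : (1 + ‖z‖) ^ 4 ≤ 16 * ‖z‖ ^ 4 := by
      have h3 : 1 + ‖z‖ ≤ 2 * ‖z‖ := by linarith
      calc (1 + ‖z‖) ^ 4 ≤ (2 * ‖z‖) ^ 4 := pow_le_pow_left₀ (by positivity) h3 4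
        _ = 16 * ‖z‖ ^ 4 := by ring
    have h5 : (‖z‖ ^ 4)⁻¹ ≤ 16 * ((1 + ‖z‖) ^ 4)⁻¹ := by
      rw [← div_eq_mul_inv, le_div_iff₀ (by positivity)]
      calc (‖z‖ ^ 4)⁻¹ * (1 + ‖z‖) ^ 4 ≤ (‖z‖ ^ 4)⁻¹ * (16 * ‖z‖ ^ 4) := by gcongr
        _ = 16 := by field_simp
    have e : ((4 * π * ‖z‖ ^ 2)⁻¹) ^ 2 = (4 * π)⁻¹ ^ 2 * (‖z‖ ^ 4)⁻¹ := by
      rw [mul_inv, mul_pow, inv_pow, inv_pow, ← pow_mul]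
    rw [h2, e]
    calc (4 * π)⁻¹ ^ 2 * (‖z‖ ^ 4)⁻¹ ≤ (4 * π)⁻¹ ^ 2 * (16 * ((1 + ‖z‖) ^ 4)⁻¹) := by gcongr
      _ = 16 * (4 * π)⁻¹ ^ 2 * ((1 + ‖z‖) ^ 4)⁻¹ := by ring
  · rw [indicator_of_notMem hz]
    simp only [ne_eq, OfNat.ofNat_ne_zero, not_false_eq_true, zero_pow]
    positivity


/-! ## The force potential: measurability, pointwise majorant, `L²` bound -/

section Potential

variable {g : (EuclideanSpace ℝ (Fin 3)) → (EuclideanSpace ℝ (Fin 3))} {M : ℝ}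

/-- The integrand of `Δ⁻¹∇·g (x)` is dominated by the majorant kernel:
`|∇Γ(x-y)·g(y)| ≤ κ(x-y)|g(y)|`. [cite: GilbargTrudinger2001, (2.14)] -/
theorem norm_forceKernel_sub_apply_le (g : (EuclideanSpace ℝ (Fin 3)) → (EuclideanSpace ℝ (Fin 3))) (x y : (EuclideanSpace ℝ (Fin 3))) :
    ‖forceKernel (x - y) (g y)‖ ≤ (4 * π * ‖x - y‖ ^ 2)⁻¹ * ‖g y‖ := by
  rw [Real.norm_eq_abs]
  exact abs_forceKernel_le _ _

/-- Joint measurability of `(x, y) ↦ ∇Γ(x-y)·g(y)` for measurable `g`. [folklore] -/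
private theorem measurable_forceKernel_sub_apply (hg : Measurable g) :
    Measurable fun z : (EuclideanSpace ℝ (Fin 3)) × (EuclideanSpace ℝ (Fin 3)) => forceKernel (z.1 - z.2) (g z.2) := by
  have e : (fun z : (EuclideanSpace ℝ (Fin 3)) × (EuclideanSpace ℝ (Fin 3)) => forceKernel (z.1 - z.2) (g z.2)) =
      fun z : (EuclideanSpace ℝ (Fin 3)) × (EuclideanSpace ℝ (Fin 3)) => ⟪z.1 - z.2, g z.2⟫ * (4 * π * ‖z.1 - z.2‖ ^ 3)⁻¹ := by
    funext z; rw [forceKernel_eq_fin3, div_eq_mul_inv]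
  rw [e]
  have h1 : Measurable fun z : (EuclideanSpace ℝ (Fin 3)) × (EuclideanSpace ℝ (Fin 3)) => z.1 - z.2 := measurable_fst.sub measurable_snd
  have h2 : Measurable fun z : (EuclideanSpace ℝ (Fin 3)) × (EuclideanSpace ℝ (Fin 3)) => g z.2 := hg.comp measurable_snd
  exact (h1.inner h2).mul ((measurable_const.mul (h1.norm.pow_const 3)).inv)

/-- **`Δ⁻¹∇·g` is a.e. strongly measurable** for measurable `g` (Tao's force potential (9), a
parametric integral of a jointly measurable integrand). [cite: Tao2011, (9) p. 5] -/
theorem aestronglyMeasurable_forcePotential (hg : Measurable g) :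
    AEStronglyMeasurable (forcePotential g) volume := by
  have h := (measurable_forceKernel_sub_apply hg).stronglyMeasurable
  have : forcePotential g = fun x => ∫ y, (fun x y => forceKernel (x - y) (g y)) x y := by
    funext x; rfl
  rw [this]
  exact (StronglyMeasurable.integral_prod_right (f := fun x y : (EuclideanSpace ℝ (Fin 3)) => forceKernel (x - y) (g y))
    h).aestronglyMeasurable

/-- The split of the majorant: `κ = κ₁ + κ₂`. [folklore] -/
private theorem forceMajorant_eq_near_add_far (z : (EuclideanSpace ℝ (Fin 3))) :
    (4 * π * ‖z‖ ^ 2)⁻¹ =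
      (ball (0 : (EuclideanSpace ℝ (Fin 3))) 1).indicator (fun z : (EuclideanSpace ℝ (Fin 3)) => (4 * π * ‖z‖ ^ 2)⁻¹) z +
        (ball (0 : (EuclideanSpace ℝ (Fin 3))) 1)ᶜ.indicator (fun z : (EuclideanSpace ℝ (Fin 3)) => (4 * π * ‖z‖ ^ 2)⁻¹) z := by
  rw [← Pi.add_apply, Set.indicator_self_add_compl]

/-- The far part of the majorant is bounded by `(4π)⁻¹`. [folklore] -/
private theorem forceMajorant_far_le (z : (EuclideanSpace ℝ (Fin 3))) :
    (ball (0 : (EuclideanSpace ℝ (Fin 3))) 1)ᶜ.indicator (fun z : (EuclideanSpace ℝ (Fin 3)) => (4 * π * ‖z‖ ^ 2)⁻¹) z ≤ (4 * π)⁻¹ := by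
  by_cases hz : z ∈ (ball (0 : (EuclideanSpace ℝ (Fin 3))) 1)ᶜ
  · rw [indicator_of_mem hz]
    rw [mem_compl_iff, mem_ball_zero_iff, not_lt] at hz
    rw [mul_inv]
    refine mul_le_of_le_one_right (by positivity) ?_
    rw [inv_le_one_iff₀]
    exact Or.inr (one_le_pow₀ hz)
  · rw [indicator_of_notMem hz]; positivity

/-- **Integrability of the dominated integrand at every point**: for `g` continuous, bounded and
integrable, `y ↦ κ(x-y)|g(y)|` is integrable for every `x` (near part: `κ₁ ∈ L¹` against bounded
`g`; far part: `κ₂ ≤ (4π)⁻¹` against `g ∈ L¹`). [folklore] -/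
private theorem integrable_forceMajorant_sub_mul_norm (hg : Continuous g) (hgi : Integrable g)
    (hM : ∀ x, ‖g x‖ ≤ M) (x : (EuclideanSpace ℝ (Fin 3))) :
    Integrable (fun y => (ball (0 : (EuclideanSpace ℝ (Fin 3))) 1).indicator (fun z : (EuclideanSpace ℝ (Fin 3)) => (4 * π * ‖z‖ ^ 2)⁻¹) (x - y) *
      ‖g y‖) ∧
    Integrable (fun y => (ball (0 : (EuclideanSpace ℝ (Fin 3))) 1)ᶜ.indicator (fun z : (EuclideanSpace ℝ (Fin 3)) => (4 * π * ‖z‖ ^ 2)⁻¹) (x - y) *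
      ‖g y‖) := by
  constructor
  · have h1 := integrable_forceMajorant_near.comp_sub_left x
    have h2 : Integrable (fun y => ‖g y‖ *
        (ball (0 : (EuclideanSpace ℝ (Fin 3))) 1).indicator (fun z : (EuclideanSpace ℝ (Fin 3)) => (4 * π * ‖z‖ ^ 2)⁻¹) (x - y)) :=
      h1.bdd_mul hg.norm.aestronglyMeasurable (c := M)
        (Eventually.of_forall fun y => by rw [Real.norm_of_nonneg (norm_nonneg _)]; exact hM y)
    exact h2.congr (Eventually.of_forall fun y => mul_comm _ _)
  · refine (hgi.norm.const_mul (4 * π)⁻¹).mono' ?_ (Eventually.of_forall fun y => ?_)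
    · exact (((measurable_forceMajorant.indicator measurableSet_ball.compl).comp
        (measurable_const.sub measurable_id)).aestronglyMeasurable).mul
          hg.norm.aestronglyMeasurable
    · rw [Real.norm_of_nonneg (mul_nonneg (Set.indicator_nonneg (fun z _ => forceMajorant_nonneg z) _)
        (norm_nonneg _))]
      exact mul_le_mul_of_nonneg_right (forceMajorant_far_le _) (norm_nonneg _)

/-- **Pointwise majorant of the force potential**:
`|Δ⁻¹∇·g (x)| ≤ ∫ κ₁(x-y)|g(y)| dy + ∫ κ₂(x-y)|g(y)| dy` for every `x`. [cite: GilbargTrudinger2001, (2.14)] -/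
theorem norm_forcePotential_le (hg : Continuous g) (hgi : Integrable g) (hM : ∀ x, ‖g x‖ ≤ M)
    (x : (EuclideanSpace ℝ (Fin 3))) :
    ‖forcePotential g x‖ ≤
      (∫ y, (ball (0 : (EuclideanSpace ℝ (Fin 3))) 1).indicator (fun z : (EuclideanSpace ℝ (Fin 3)) => (4 * π * ‖z‖ ^ 2)⁻¹) (x - y) * ‖g y‖) +
        ∫ y, (ball (0 : (EuclideanSpace ℝ (Fin 3))) 1)ᶜ.indicator (fun z : (EuclideanSpace ℝ (Fin 3)) => (4 * π * ‖z‖ ^ 2)⁻¹) (x - y) * ‖g y‖ := by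
  obtain ⟨i1, i2⟩ := integrable_forceMajorant_sub_mul_norm hg hgi hM x
  rw [forcePotential, ← integral_add i1 i2]
  refine (norm_integral_le_integral_norm _).trans (integral_mono_of_nonneg
    (Eventually.of_forall fun y => norm_nonneg _) (i1.add i2) (Eventually.of_forall fun y => ?_))
  dsimp only
  rw [← add_mul, ← forceMajorant_eq_near_add_far]
  exact norm_forceKernel_sub_apply_le g x y

/-- A continuous, bounded, integrable field is square integrable. [folklore] -/
private theorem memLp_two_of_bounded_integrable (hg : Continuous g) (hgi : Integrable g)
    (hM : ∀ x, ‖g x‖ ≤ M) : MemLp g 2 volume := by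
  rw [← memLp_norm_iff hg.aestronglyMeasurable,
    memLp_two_iff_integrable_sq hg.norm.aestronglyMeasurable]
  refine (hgi.norm.const_mul M).mono' ((hg.norm.pow 2).aestronglyMeasurable)
    (Eventually.of_forall fun y => ?_)
  rw [Real.norm_of_nonneg (sq_nonneg _), sq]
  exact mul_le_mul_of_nonneg_right (hM y) (norm_nonneg _)

/-- `(lsmul ℝ ℝ).flip = lsmul ℝ ℝ` (real multiplication is commutative). [folklore] -/
private theorem lsmul_flip_eq : (ContinuousLinearMap.lsmul ℝ ℝ : ℝ →L[ℝ] ℝ →L[ℝ] ℝ).flip =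
    ContinuousLinearMap.lsmul ℝ ℝ := by
  ext
  simp

/-- **The `L²` bound for the force potential (Young's inequality).** For `g : ℝ³ → ℝ³` continuous,
bounded and integrable,
`‖Δ⁻¹∇·g‖_{L²} ≤ ‖κ₁‖_{L¹} ‖g‖_{L²} + ‖g‖_{L¹} ‖κ₂‖_{L²}`, `κ₁ = (4π|z|²)⁻¹1_{|z|<1}`,
`κ₂ = (4π|z|²)⁻¹1_{|z|≥1}`. [cite: GilbargTrudinger2001, (2.12)–(2.14)] -/
theorem eLpNorm_forcePotential_le (hg : Continuous g) (hgi : Integrable g) (hM : ∀ x, ‖g x‖ ≤ M) :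
    eLpNorm (forcePotential g) 2 volume ≤
      (∫⁻ z, ‖(ball (0 : (EuclideanSpace ℝ (Fin 3))) 1).indicator (fun z : (EuclideanSpace ℝ (Fin 3)) => (4 * π * ‖z‖ ^ 2)⁻¹) z‖ₑ) *
          eLpNorm g 2 volume +
        (∫⁻ y, ‖g y‖ₑ) *
          eLpNorm ((ball (0 : (EuclideanSpace ℝ (Fin 3))) 1)ᶜ.indicator fun z : (EuclideanSpace ℝ (Fin 3)) => (4 * π * ‖z‖ ^ 2)⁻¹) 2 volume := by
  set κ₁ : (EuclideanSpace ℝ (Fin 3)) → ℝ := (ball (0 : (EuclideanSpace ℝ (Fin 3))) 1).indicator fun z : (EuclideanSpace ℝ (Fin 3)) => (4 * π * ‖z‖ ^ 2)⁻¹ with hκ₁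
  set κ₂ : (EuclideanSpace ℝ (Fin 3)) → ℝ := (ball (0 : (EuclideanSpace ℝ (Fin 3))) 1)ᶜ.indicator fun z : (EuclideanSpace ℝ (Fin 3)) => (4 * π * ‖z‖ ^ 2)⁻¹ with hκ₂
  set N : (EuclideanSpace ℝ (Fin 3)) → ℝ := fun y => ‖g y‖ with hN
  have hNc : Continuous N := hg.norm
  have hNi : Integrable N := hgi.norm
  have hN2 : MemLp N 2 volume := (memLp_two_of_bounded_integrable hg hgi hM).norm
  have hκ₁m : AEStronglyMeasurable κ₁ volume :=
    (measurable_forceMajorant.indicator measurableSet_ball).aestronglyMeasurable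
  have hκ₂m : AEStronglyMeasurable κ₂ volume :=
    (measurable_forceMajorant.indicator measurableSet_ball.compl).aestronglyMeasurable
  -- the two convolutions
  have hC₁ : ∀ x, (convolution N κ₁ (ContinuousLinearMap.lsmul ℝ ℝ) volume) x = ∫ y, κ₁ (x - y) * ‖g y‖ := by
    intro x
    rw [convolution_lsmul]
    exact integral_congr_ae (Eventually.of_forall fun y => by simp [hN, mul_comm])
  have hC₂ : ∀ x, (convolution N κ₂ (ContinuousLinearMap.lsmul ℝ ℝ) volume) x = ∫ y, κ₂ (x - y) * ‖g y‖ := by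
    intro x
    rw [convolution_lsmul]
    exact integral_congr_ae (Eventually.of_forall fun y => by simp [hN, mul_comm])
  have hflip : convolution N κ₁ (ContinuousLinearMap.lsmul ℝ ℝ) volume =
      convolution κ₁ N (ContinuousLinearMap.lsmul ℝ ℝ) volume := by
    rw [← convolution_flip, lsmul_flip_eq]
  have hm₁ : AEStronglyMeasurable (convolution N κ₁ (ContinuousLinearMap.lsmul ℝ ℝ) volume) volume := by
    rw [hflip]
    exact (Literature.Analysis.UnboundedOperators.memLp_convolution_lsmul
      integrable_forceMajorant_near hN2 one_le_two).aestronglyMeasurable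
  have hm₂ : AEStronglyMeasurable (convolution N κ₂ (ContinuousLinearMap.lsmul ℝ ℝ) volume) volume :=
    (Literature.Analysis.UnboundedOperators.memLp_convolution_lsmul hNi memLp_forceMajorant_far
      one_le_two).aestronglyMeasurable
  -- pointwise domination
  have hpt : ∀ x, ‖forcePotential g x‖ ≤
      ‖((convolution N κ₁ (ContinuousLinearMap.lsmul ℝ ℝ) volume) +
        (convolution N κ₂ (ContinuousLinearMap.lsmul ℝ ℝ) volume)) x‖ := by
    intro x
    rw [Pi.add_apply, hC₁, hC₂]
    refine (norm_forcePotential_le hg hgi hM x).trans ?_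
    exact le_abs_self _
  calc eLpNorm (forcePotential g) 2 volume
      ≤ eLpNorm ((convolution N κ₁ (ContinuousLinearMap.lsmul ℝ ℝ) volume) +
          (convolution N κ₂ (ContinuousLinearMap.lsmul ℝ ℝ) volume)) 2 volume := eLpNorm_mono hpt
    _ ≤ eLpNorm (convolution N κ₁ (ContinuousLinearMap.lsmul ℝ ℝ) volume) 2 volume +
          eLpNorm (convolution N κ₂ (ContinuousLinearMap.lsmul ℝ ℝ) volume) 2 volume :=
        eLpNorm_add_le hm₁ hm₂ one_le_two
    _ ≤ (∫⁻ z, ‖κ₁ z‖ₑ) * eLpNorm N 2 volume + (∫⁻ y, ‖N y‖ₑ) * eLpNorm κ₂ 2 volume := by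
        gcongr
        · rw [hflip]
          exact Literature.Analysis.UnboundedOperators.eLpNorm_convolution_le_lintegral_enorm_mul
            hκ₁m hNc.aestronglyMeasurable one_le_two
        · exact Literature.Analysis.UnboundedOperators.eLpNorm_convolution_le_lintegral_enorm_mul
            hNc.aestronglyMeasurable hκ₂m one_le_two
    _ = (∫⁻ z, ‖κ₁ z‖ₑ) * eLpNorm g 2 volume + (∫⁻ y, ‖g y‖ₑ) * eLpNorm κ₂ 2 volume := by
        rw [hN, eLpNorm_norm]
        simp only [enorm_norm]

/-- **`Δ⁻¹∇·g ∈ L²(ℝ³)`** for `g` continuous, bounded and integrable: the two constants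
`‖κ₁‖_{L¹}`, `‖κ₂‖_{L²}` are finite (`integrable_forceMajorant_near`, `memLp_forceMajorant_far`).
[cite: GilbargTrudinger2001, (2.12)–(2.14)] -/
theorem eLpNorm_forcePotential_lt_top (hg : Continuous g) (hgi : Integrable g)
    (hM : ∀ x, ‖g x‖ ≤ M) : eLpNorm (forcePotential g) 2 volume < ⊤ := by
  refine (eLpNorm_forcePotential_le hg hgi hM).trans_lt (ENNReal.add_lt_top.2 ⟨?_, ?_⟩)
  · exact ENNReal.mul_lt_top integrable_forceMajorant_near.2
      (memLp_two_of_bounded_integrable hg hgi hM).eLpNorm_lt_top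
  · exact ENNReal.mul_lt_top hgi.2 memLp_forceMajorant_far.eLpNorm_lt_top

/-- **`Δ⁻¹∇·g ∈ L²(ℝ³)`**, `MemLp` form. [cite: GilbargTrudinger2001, (2.12)–(2.14)] -/
theorem memLp_forcePotential (hg : Continuous g) (hgi : Integrable g) (hM : ∀ x, ‖g x‖ ≤ M) :
    MemLp (forcePotential g) 2 volume :=
  ⟨aestronglyMeasurable_forcePotential hg.measurable, eLpNorm_forcePotential_lt_top hg hgi hM⟩

/-- **The `∫⁻`-form used downstream**: `∫ |Δ⁻¹∇·g|² = ‖Δ⁻¹∇·g‖²_{L²} < ⊤`. [cite: GilbargTrudinger2001, (2.12)–(2.14)] -/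
theorem lintegral_enorm_sq_forcePotential_lt_top (hg : Continuous g) (hgi : Integrable g)
    (hM : ∀ x, ‖g x‖ ≤ M) : ∫⁻ x, ‖forcePotential g x‖ₑ ^ 2 < ⊤ := by
  have h := eLpNorm_forcePotential_lt_top hg hgi hM
  have := lintegral_rpow_enorm_lt_top_of_eLpNorm_lt_top (by norm_num : (2 : ℝ≥0∞) ≠ 0)
    (by norm_num : (2 : ℝ≥0∞) ≠ ⊤) h
  simpa [ENNReal.rpow_two] using this

end Potential

end Literature.Analysis.FluidPDE

end
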